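import Mathlib
import HarnessLib

/-!
# Magnen–Rivasseau–Sénéor, *Construction of YM₄ with an infrared cutoff* (CMP 155, 1993), §II.B p.337 tl.30–37: «a ∇B field of scale i₂
# produced at level i₁ > i₂ is evaluated by a factor λ_{i₂}^{−1/2}M^{2i₂} ≤ λ_{i₁}^{−1/2}M^{2i₁}M^{−2(i₁−i₂)}. The local factorials created
# by accumulation of many ∇B factors coming from the many boxes of scale i₁ in the same box of scale i₂ are then compensated by the
# M^{−2(i₁−i₂)} factors» — PROVED as arithmetic: the scale part of the printed inequality is an identity and its content is the
# monotonicity of the tentative couplings; and `√(n!)·(M^{−2(i₁−i₂)})ⁿ ≤ p^{n/2}` whenever `n ≤ p·M^{4(i₁−i₂)}` fields accumulate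
# (at most `p` from each of the `M^{4(i₁−i₂)}` sub-boxes) — the local factorial IS compensated, box by box

elementary real arithmetic (`n! ≤ nⁿ`); nothing here is a claim about the Yang–Mills mass gap, about continuum YM₄ on `T⁴` (with or
without infrared cutoff), or about the Clay problem — and nothing of the expansion (II.29a), of the functional integral producing the
«∇B factors», of Lemma II.1 («The rest of the argument is as in Lemma II.1») or of the choice of `P_{1,i}` is asserted or formalised

**Citation header (reproduction of PUBLISHED work).** J. Magnen, V. Rivasseau, R. Sénéor, *Construction of YM₄ with an infrared
cutoff*, Commun. Math. Phys. **155** (1993) 325–383 [MagnenRivasseauSeneor1993], §II.B p.337 tl.30–37 (re-read on the page image of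
record `run/shared/lean/pub/lit-balaban/inprint/lit-balaban-p14/renders-cmp155/p13_full_s6.png`; loci «p.NNN tl.k» = journal page ∕
text-layer line of `paper:magnen1993-cmp155-mrs-ym4-infrared-cutoff`, PDF page = journal page − 324). Cell pub-balaban-gaps (YM blitz,
track G3), seat mrs-lit-2 (gen 18, file 50); companion record `run/shared/lean/pub/pub-balaban-gaps/g3/MRS-AS-PRINTED-estimates.md`.
Siblings referred to BY NAME only (not imported, to keep this file Mathlib-only): `…MRS93NestedLattices` (`NestedLattices.card_fineLabels_isotropic`:
a box of `𝐃_{i₂,i₂}` contains `M^{4(i₁−i₂)}` boxes of `𝐃_{i₁,i₁}` — the number `B` below), `…MRS93LargeFieldRegions` ∕ `…MRS93PhaseCells`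
((II.29b) `H_Δ` with its prefactor `(λ_i^t)^{1−ε₁/64}M^{−2i}`), `…MRS93StartingAnsatz` (the tentative couplings (II.12)),
`…MRS93BoxMatchedDecay` ∕ `…MRS93LargeFieldSmallFactor` ((II.28), «product of local factorials»).

**What the paper prints (verbatim, p.337 [PDF 13]).**
* (II.29b) tl.15–16: *«H_Δ = (1/Δ) ∫_Δ ((λ_i^t)^{1−(ε₁/64)} M^{−2i} ∇B(Δ, x))^{P_{1,i}}, (II.29b) where P_{1,i} is an even integer close to
  (λ_i^t)^{−ε₁/32}»*.
* tl.30–37: *«Before the final bounds are derived, let us again explain in anticipation why the boxes with the error terms have a small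
  factor attached to them. The reasoning is similar to the sketch of proof of Lemma II.1. This is because a ∇B field of scale i₂ produced
  at level i₁ > i₂ is evaluated by a factor λ_{i₂}^{−1/2}M^{2i₂} ≤ λ_{i₁}^{−1/2}M^{2i₁}M^{−2(i₁−i₂)}. The local factorials created by
  accumulation of many ∇B factors coming from the many boxes of scale i₁ in the same box of scale i₂ are then compensated by the
  M^{−2(i₁−i₂)} factors. The rest of the argument is as in Lemma II.1, the value of P_{1,i} being adapted for it to work.»*
* p.336 [PDF 12] tl.19–21 (the local factorials): *«As is usual when the spatial decrease of the propagator is matched to the shape of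
  the boxes in which the cluster expansion is performed, we obtain a product of local factorials in the number of the fields in each box
  [R].»*

**What is formalised (every statement below is a `theorem` with its proof).**
* §1 THE EVALUATION FACTOR (tl.33–34): `scale_factor_eq` (`M^{2i₂} = M^{2i₁}·M^{−2(i₁−i₂)}`, an identity), **`evalFactor_le`** (the printed
  inequality for `0 < λ_{i₁} ≤ λ_{i₂}`, `M > 0`), **`le_of_evalFactor_le`** (conversely the printed inequality FORCES `λ_{i₁} ≤ λ_{i₂}`: its
  content is exactly that the tentative coupling does not grow from `i₂` to the higher index `i₁`), `prefactor_mul_evalFactor` (with the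
  (II.29b) prefactor `(λ_{i₁}^t)^{1−ε₁/64}M^{−2i₁}` of the testing box the scale part left over is exactly `M^{−2(i₁−i₂)}`).
* §2 THE COMPENSATION (tl.34–36): `sqrt_factorial_le_pow_half` (`√(n!) ≤ n^{n/2}`, from Mathlib's `Nat.factorial_le_pow`),
  **`sqrt_factorial_mul_pow_le`** (abstract: `n ≤ p·B` ⟹ `√(n!)·(B^{−1/2})ⁿ ≤ p^{n/2}`), **`sqrt_factorial_mul_scale_pow_le`** (the printed
  letters: `n ≤ p·M^{4k}` accumulated fields, each carrying `M^{−2k}`, `k = i₁ − i₂` ⟹ `√(n!)·(M^{−2k})ⁿ ≤ p^{n/2}`),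
  **`prod_sqrt_factorial_mul_scale_pow_le`** (box by box over any finite family of boxes of scale `i₂`: «a product of local factorials»).

**Reading conventions.** (i) «evaluated by a factor λ_{i₂}^{−1/2}M^{2i₂}» — the typical size of a gradient field of scale `i₂` (cf. p.336
tl.9–10 «a typical size M^iλ^{−1/2}» for the field; one more `M^{i₂}` for the gradient); typed as the real number `λ₂^{−1/2}M^{2i₂}` with
`λ₂ = λ_{i₂}^t`, `λ₁ = λ_{i₁}^t` positive parameters. (ii) «the many boxes of scale i₁ in the same box of scale i₂» = `B = M^{4(i₁−i₂)}`
boxes (isotropic lattices; file 46's count, quoted by name); «accumulation of many ∇B factors» = `n ≤ p·B` fields in the box of scale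
`i₂`, at most `p` per sub-box (`p` abstract: the print's «the value of P_{1,i} being adapted»); the local factorial of `n` fields in one
box = `√(n!)` ([R] Lemma II.6.2 ∕ (III.1.24), the tree's `LocalFactorialBound` currency). (iii) `λ` is a Lean keyword: couplings are
spelled `lam`.

**As-printed precision (ae) (recorded, NOT adjudicated).** Since `M^{2i₂} = M^{2i₁}M^{−2(i₁−i₂)}` identically, the printed «≤» holds iff
`λ_{i₁}^t ≤ λ_{i₂}^t` for `i₁ > i₂` (`le_of_evalFactor_le`) — the asymptotic-freedom monotonicity of the tentative couplings (II.12), which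
the ansatz (II.11) delivers for `ρ` large (denominator `−β₂(log M)ρ + (β₃/β₂)log ρ + C` eventually increasing, `β₂ < 0`) but which is not a
displayed statement of the paper; it enters here as the hypothesis `hmono`.

**What is NOT claimed.** That the functional integral produces these factors (the expansion (II.29a) and its error term, Sects. II.B ∕
VII), the monotonicity of (II.12) itself, Lemma II.1, the adaptation of `P_{1,i}`; anything of Bałaban's papers. MRS work at FIXED
INFRARED CUTOFF: nothing here bears on infinite volume or a mass gap.
-/

noncomputable section

open Finset

namespace Literature.MathematicalPhysics.QuantumFieldTheory.MagnenRivasseauSeneor1993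

namespace GradientCompensation

/-! ## §1 «a ∇B field of scale i₂ produced at level i₁ > i₂ is evaluated by a factor λ_{i₂}^{−1/2}M^{2i₂} ≤
λ_{i₁}^{−1/2}M^{2i₁}M^{−2(i₁−i₂)}» (p.337 tl.33–34) -/

/-- The scale bookkeeping of the printed inequality is an IDENTITY: `M^{2i₂} = M^{2i₁}·M^{−2(i₁−i₂)}` (`M ≠ 0`, integer exponents).
[cite: MagnenRivasseauSeneor1993, §II.B p.337 tl.33–34] -/
theorem scale_factor_eq {M : ℝ} (hM : M ≠ 0) (i₁ i₂ : ℕ) :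
    M ^ (2 * (i₂ : ℤ)) = M ^ (2 * (i₁ : ℤ)) * M ^ (-(2 * ((i₁ : ℤ) - i₂))) := by
  rw [← zpow_add₀ hM]; ring_nf

/-- **The printed evaluation bound**: `λ_{i₂}^{−1/2}M^{2i₂} ≤ λ_{i₁}^{−1/2}M^{2i₁}M^{−2(i₁−i₂)}` — given the scale identity, exactly the
statement that the tentative coupling does not increase from `i₂` to the higher index `i₁` (`0 < λ_{i₁} ≤ λ_{i₂}`, asymptotic freedom of
the ansatz (II.11)–(II.12); a hypothesis here). [cite: MagnenRivasseauSeneor1993, §II.B p.337 tl.33–34] -/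
theorem evalFactor_le {M lam₁ lam₂ : ℝ} (hM : 0 < M) (hlam₁ : 0 < lam₁) (hmono : lam₁ ≤ lam₂) (i₁ i₂ : ℕ) :
    lam₂ ^ (-(1 / 2 : ℝ)) * M ^ (2 * (i₂ : ℤ)) ≤ lam₁ ^ (-(1 / 2 : ℝ)) * (M ^ (2 * (i₁ : ℤ)) * M ^ (-(2 * ((i₁ : ℤ) - i₂)))) := by
  rw [← scale_factor_eq hM.ne' i₁ i₂]
  refine mul_le_mul_of_nonneg_right ?_ (zpow_nonneg hM.le _)
  exact Real.rpow_le_rpow_of_nonpos hlam₁ hmono (by norm_num)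

/-- Conversely, with equality of the scale parts, the printed inequality FORCES `λ_{i₁} ≤ λ_{i₂}` (`M > 0`): it is a monotonicity
statement about the couplings, nothing else. [cite: MagnenRivasseauSeneor1993, §II.B p.337 tl.33–34] -/
theorem le_of_evalFactor_le {M lam₁ lam₂ : ℝ} (hM : 0 < M) (hlam₂ : 0 < lam₂) (i₁ i₂ : ℕ)
    (h : lam₂ ^ (-(1 / 2 : ℝ)) * M ^ (2 * (i₂ : ℤ)) ≤
      lam₁ ^ (-(1 / 2 : ℝ)) * (M ^ (2 * (i₁ : ℤ)) * M ^ (-(2 * ((i₁ : ℤ) - i₂))))) : lam₁ ≤ lam₂ := by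
  rw [← scale_factor_eq hM.ne' i₁ i₂] at h
  have hpos : 0 < M ^ (2 * (i₂ : ℤ)) := zpow_pos hM _
  have h' : lam₂ ^ (-(1 / 2 : ℝ)) ≤ lam₁ ^ (-(1 / 2 : ℝ)) := le_of_mul_le_mul_right h hpos
  by_contra hlt
  rw [not_le] at hlt
  have := Real.rpow_lt_rpow_of_neg hlam₂ hlt (show (-(1 / 2 : ℝ)) < 0 by norm_num)
  linarith

/-! ## §2 «The local factorials created by accumulation of many ∇B factors coming from the many boxes of scale i₁ in the same box of
scale i₂ are then compensated by the M^{−2(i₁−i₂)} factors» (p.337 tl.34–36) -/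

/-- `√(n!) ≤ n^{n/2}` (from `n! ≤ nⁿ`). [cite: MagnenRivasseauSeneor1993, §II.B p.337 tl.34–36] -/
theorem sqrt_factorial_le_pow_half (n : ℕ) : Real.sqrt (n.factorial : ℝ) ≤ (n : ℝ) ^ ((n : ℝ) / 2) := by
  have h1 : ((n.factorial : ℕ) : ℝ) ≤ ((n ^ n : ℕ) : ℝ) := by exact_mod_cast Nat.factorial_le_pow n
  rw [Real.sqrt_eq_rpow]
  calc ((n.factorial : ℝ)) ^ (1 / 2 : ℝ) ≤ ((n : ℝ) ^ n) ^ (1 / 2 : ℝ) := by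
        apply Real.rpow_le_rpow (by positivity) (by exact_mod_cast Nat.factorial_le_pow n) (by norm_num)
    _ = (n : ℝ) ^ ((n : ℝ) / 2) := by
        rw [← Real.rpow_natCast, ← Real.rpow_mul (Nat.cast_nonneg n)]; ring_nf

/-- **Compensation, abstract form**: if at most `n ≤ p·B` fields accumulate in a box (`B ≥ 1` the number of sub-boxes feeding it, at most
`p` fields each) and every field carries the factor `B^{−1/2}`, the local factorial is paid for: `√(n!)·(B^{−1/2})ⁿ ≤ p^{n/2}`.
[cite: MagnenRivasseauSeneor1993, §II.B p.337 tl.34–36] -/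
theorem sqrt_factorial_mul_pow_le {B p : ℝ} {n : ℕ} (hB : 0 < B) (hp : 0 ≤ p) (hn : (n : ℝ) ≤ p * B) :
    Real.sqrt (n.factorial : ℝ) * (B ^ (-(1 / 2 : ℝ))) ^ n ≤ p ^ ((n : ℝ) / 2) := by
  have h1 := sqrt_factorial_le_pow_half n
  have hn0 : (0 : ℝ) ≤ n := Nat.cast_nonneg n
  -- n^{n/2} ≤ (pB)^{n/2} = p^{n/2} B^{n/2}
  have h2 : (n : ℝ) ^ ((n : ℝ) / 2) ≤ (p * B) ^ ((n : ℝ) / 2) := Real.rpow_le_rpow hn0 hn (by positivity)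
  have h3 : (p * B) ^ ((n : ℝ) / 2) = p ^ ((n : ℝ) / 2) * B ^ ((n : ℝ) / 2) := Real.mul_rpow hp hB.le
  have h4 : (B ^ (-(1 / 2 : ℝ))) ^ n = (B ^ ((n : ℝ) / 2))⁻¹ := by
    rw [← Real.rpow_natCast, ← Real.rpow_mul hB.le, ← Real.rpow_neg hB.le]
    congr 1; ring
  have hBpos : 0 < B ^ ((n : ℝ) / 2) := Real.rpow_pos_of_pos hB _
  rw [h4, ← div_eq_mul_inv, div_le_iff₀ hBpos, ← h3]
  exact h1.trans h2

/-- **Compensation in the printed letters**: the box of scale `i₂` contains `M^{4(i₁−i₂)}` boxes of scale `i₁` (the tree's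
`NestedLattices.card_fineLabels_isotropic`, used here as the number `B = M^{4k}`, `k = i₁ − i₂`), each contributing at most `p` fields
`∇B`, each field carrying «the M^{−2(i₁−i₂)}» `= (M^{4k})^{−1/2}`: for `n ≤ p·M^{4k}` accumulated fields, `√(n!)·(M^{−2k})ⁿ ≤ p^{n/2}` —
the local factorial `√(n!)` is «compensated», what remains is a per-field constant `√p`. [cite: MagnenRivasseauSeneor1993, §II.B
p.337 tl.34–36] -/
theorem sqrt_factorial_mul_scale_pow_le {M p : ℝ} {k n : ℕ} (hM : 0 < M) (hp : 0 ≤ p) (hn : (n : ℝ) ≤ p * M ^ (4 * k)) :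
    Real.sqrt (n.factorial : ℝ) * (M ^ (2 * k))⁻¹ ^ n ≤ p ^ ((n : ℝ) / 2) := by
  have hB : 0 < M ^ (4 * k) := pow_pos hM _
  have h := sqrt_factorial_mul_pow_le hB hp hn
  have hkey : (M ^ (4 * k) : ℝ) ^ (-(1 / 2 : ℝ)) = (M ^ (2 * k))⁻¹ := by
    rw [Real.rpow_neg hB.le, ← Real.rpow_natCast M (4 * k), ← Real.rpow_mul hM.le, ← Real.rpow_natCast M (2 * k)]
    congr 2; push_cast; ring
  rwa [hkey] at h

/-- The same over a finite family of boxes of scale `i₂`: if every box `Δ` receives `n_Δ ≤ p·M^{4k}` fields, then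
`∏_Δ √(n_Δ!) · (M^{−2k})^{Σ n_Δ} ≤ ∏_Δ p^{n_Δ/2}` — the «product of local factorials» ([R]; (II.28)) is compensated box by box.
[cite: MagnenRivasseauSeneor1993, §II.B p.337 tl.34–36; p.336 tl.19–21] -/
theorem prod_sqrt_factorial_mul_scale_pow_le {ι : Type*} (S : Finset ι) (nΔ : ι → ℕ) {M p : ℝ} {k : ℕ} (hM : 0 < M)
    (hp : 0 ≤ p) (hn : ∀ Δ ∈ S, (nΔ Δ : ℝ) ≤ p * M ^ (4 * k)) :
    (∏ Δ ∈ S, Real.sqrt ((nΔ Δ).factorial : ℝ)) * (M ^ (2 * k))⁻¹ ^ (∑ Δ ∈ S, nΔ Δ) ≤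
      ∏ Δ ∈ S, p ^ (((nΔ Δ : ℕ) : ℝ) / 2) := by
  rw [← Finset.prod_pow_eq_pow_sum, ← Finset.prod_mul_distrib]
  refine Finset.prod_le_prod (fun Δ _ => by positivity) fun Δ hΔ => ?_
  exact sqrt_factorial_mul_scale_pow_le hM hp (hn Δ hΔ)

/-- The prefactor of (II.29b) in the same bookkeeping: the field `∇B` of scale `i₂` tested in a box of scale `i₁` enters `H_Δ` with
`(λ_{i₁}^t)^{1−ε₁/64}M^{−2i₁}`; multiplied by the evaluation factor `λ_{i₂}^{−1/2}M^{2i₂}` of the field this leaves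
`(λ_{i₁}^t)^{1−ε₁/64} λ_{i₂}^{−1/2} · M^{−2(i₁−i₂)}` — the scale part is exactly the compensating factor (`M > 0`).
[cite: MagnenRivasseauSeneor1993, §II.B (II.29b) p.337 tl.15–16, tl.33–36] -/
theorem prefactor_mul_evalFactor {M a b : ℝ} (hM : 0 < M) (i₁ i₂ : ℕ) :
    (a * (M ^ (2 * (i₁ : ℤ)))⁻¹) * (b * M ^ (2 * (i₂ : ℤ))) = a * b * M ^ (-(2 * ((i₁ : ℤ) - i₂))) := by
  rw [scale_factor_eq hM.ne' i₁ i₂]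
  have hpos : M ^ (2 * (i₁ : ℤ)) ≠ 0 := (zpow_pos hM _).ne'
  field_simp

end GradientCompensation

end Literature.MathematicalPhysics.QuantumFieldTheory.MagnenRivasseauSeneor1993
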